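import Summits.HodgeConjecture.HodgeConjecture.Theorems.MilnorKExponentialSymbolClassesAlgebraicNashSymbolClassesAlgebraicHigh
import Literature.AlgebraicGeometry.HodgeTheory.ZariskiSymbolClassesAlgebraic
import Literature.AlgebraicGeometry.HodgeTheory.ConiveauDegreeDescent

/-!
# Stub (W_alg-band) `stub_nashHighBandAlgebraic` of the line `NashDescentSketch` — reduction to Zariski descent and Bloch–Ogus

Support file for the crux `SymbolClassesAlgebraic` (stmt-HodgeConjecture-17743, route
`MilnorKExponential`), line `NashDescentSketch`, band stub (W_alg-band)
`stub_nashHighBandAlgebraic` (the hypothesis of `nashSymbolClassesAlgebraicHigh_of_band`,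
`Theorems/MilnorKExponentialSymbolClassesAlgebraicNashSymbolClassesAlgebraicHigh`): on a smooth
projective complex `n`-fold every rational NASH symbol class `c ∈ H^{2q+2}(X(ℂ); ℂ)` of weight
`q + 1` with `2 ≤ q`, `q + 3 ≤ n` (weights `3 ≤ q + 1 ≤ n - 2`, so `n ≥ 5`; first case
`(n, q + 1) = (5, 3)`) lies in `algebraicClasses X (q + 1) = N^{q+1} H^{2q+2}`.

The idea card (`Cruxes/SymbolClassesAlgebraic/Ideas/nash-descent-weight-kill.md`, step (W_alg))
proves this by (G) globalising the Nash units of the cocycle as rational functions on a smooth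
projective `W̄`, generically finite over `X` (finite étale cover of the complement of the
branch-and-pole divisor, Hironaka), (Z) moving the resulting cocycle — analytic cover, ZARISKI
labels — into the Čech complex of a ZARISKI open cover of `W̄` (Leray for `λ : W̄^an → W̄_Zar`),
where (BO) Bloch–Ogus applies: the Leray filtration of `λ` is the coniveau filtration, so classes
transgressed from Čech cocycles of a Zariski cover lie in `Nᵖ H²ᵖ` (Bloch–Ogus (1974) Prop. (6.4),
Cor. (6.9); for cocycles of the Milnor `K`-sheaf this is the cycle class of
`Hᵖ(W̄_Zar, 𝒦^M_p) ≅ CHᵖ(W̄)`, Kerz (2009)), and finally descending along `W̄ → X` (projection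
formula: coniveau descends along morphisms of non-zero degree).

PROVED here (sorry-free; no definitions; one named fact USED, none introduced):

* `nashHighBandAlgebraic_of_zariskiDescent` (REGISTERED sub-goal) — the band stub FOLLOWS from
  `hZ`, ZARISKI DESCENT IN THE BAND (an explicit hypothesis, stated in the tree's vocabulary: for
  every rational Nash symbol class `c` of the band there are a smooth projective `n`-fold `W`, a
  morphism `φ : W ⟶ X` of non-zero degree `d` (`HasDegree μ ν φ(ℂ) d` for some orientations), a
  Hodge model `B` of `W`, Zariski opens `V_i` of `W` whose analytic opens
  `U_i = (B.toComplexPoints)⁻¹(V_i(ℂ))` cover `W^an`, a Čech `(q+1)`-cochain `w` of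
  `(q+1)`-forms and a closed `(2q+2)`-form `θ` transgressed from it (`IsTransgression`) with
  `B.deRham [θ] = m • B^*(φ^* c)`, `m ≠ 0`), and from the named fact
  `HodgeTheory.blochOgus1974_zariskiTransgression_algebraic`
  (`Literature/AlgebraicGeometry/HodgeTheory/ZariskiSymbolClassesAlgebraic`): `φ^* c` is
  algebraic on `W` by the fact, hence `c` is algebraic on `X` by degree descent
  (`mem_supportedClasses_of_map_mem_of_hasDegree`);
* `nashHighBandAlgebraic_of_zariskiCarried` — the same without base change (`W = X`);
* `nashHighBandAlgebraic_of_globalisation` — the two-step form of `hZ`: (G) `hG`, after a base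
  change of non-zero degree the class is carried by a Milnor symbol cocycle of an ANALYTIC cover
  whose units are (pull-backs of) REGULAR functions on Zariski opens ("Zariski labels"), and (Z)
  `hZL`, such Zariski-labelled symbol classes are Zariski transgressions; with the fact this gives
  the stub (`hG ∧ hZL ⇒ hZ`);
* `nashSymbolClassesAlgebraicHigh_of_zariskiDescent` — hence stub (W_alg, weights `≥ 3`)
  `NashSymbolClassesAlgebraicHigh` under `hZ` and the fact (`nashSymbolClassesAlgebraicHigh_of_band`).

NOT here (the residual, report `work/stubs/NashHighBand-report.md`): `hZ` itself, i.e. (G) — the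
identity principle for Nash germs, normalisation of `X` in `ℂ(X)(germs)`, the finite étale locus,
Hironaka, and the transport of the cocycle — and (Z) — the passage from an analytic to a Zariski
cover for cocycles with Zariski labels (étale-to-Zariski descent for `𝒦^M_p ⊗ ℚ`, re-transgression);
neither has a carrier in the tree (no sheaf cohomology on `X_Zar` or `X_ét`).

## References

* [BlochOgus1974ENS] S. Bloch, A. Ogus, Gersten's conjecture and the homology of schemes, Ann. Sci.
  ÉNS (4) 7 (1974), Prop. (6.4), Cor. (6.9), Remark (7.6).
* [Kerz2009GerstenMilnorK] M. Kerz, The Gersten conjecture for Milnor K-theory, Invent. Math. 175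
  (2009), Thm. 1.1.
* [FultonYoungTableaux1997] W. Fulton, Young Tableaux (1997), App. B §B.1 (5)–(7).
* [VoisinHodgeII2003] C. Voisin, Hodge Theory and Complex Algebraic Geometry II (2003), §9.2.4
  Prop. 9.21 (ii).
* [Hironaka1964] H. Hironaka, Resolution of singularities of an algebraic variety over a field of
  characteristic zero, Ann. of Math. 79 (1964), Main Theorem I.
-/

noncomputable section

open scoped Manifold
open CategoryTheory AlgebraicGeometry
open Literature.AlgebraicTopology.SingularHomology (HomologicalOrientation HasDegree)

-- `Summit.HodgeConjecture.HodgeConjecture.Theorems` is the mandated namespace (single-problem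
-- summit), which `linter.dupNamespace` flags on every declaration.
set_option linter.dupNamespace false

namespace Summit.HodgeConjecture.HodgeConjecture.Theorems.MilnorKExponentialNash

open Literature.AlgebraicGeometry Literature.AlgebraicGeometry.HodgeTheory
  Literature.AlgebraicGeometry.Motives Literature.Geometry.Kaehler
  Literature.NumberTheory.Transcendental

/-! ### The band stub from Zariski descent (Z0 + Z2) and Bloch–Ogus (Z1) -/

/-- **(W_alg-band) from Zariski descent and Bloch–Ogus.** Hypotheses: `hZ` — ZARISKI DESCENT IN
THE BAND: for a rational Nash symbol class `c` of weight `q + 1`, `2 ≤ q`, `q + 3 ≤ n`, on a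
smooth projective `n`-fold `X` there are a smooth projective `n`-fold `W`, a morphism `φ : W ⟶ X`
of non-zero degree (`HasDegree μ ν φ(ℂ) d`, `d ≠ 0`: e.g. a generically finite surjection, or the
identity), a Hodge model `B` of `W`, Zariski opens `V_i ⊆ W` whose analytic opens
`U_i = (B.toComplexPoints)⁻¹(V_i(ℂ))` cover `W^an`, a Čech `(q+1)`-cochain `w` of `(q+1)`-forms of
that cover and a closed `(2q+2)`-form `θ` transgressed from `w` (`IsTransgression`, the zig-zag of
Bott–Tu Prop. 8.8) with `B.deRham [θ] = m • B^*(φ^* c)` for an integer `m ≠ 0` (steps (G) and (Z)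
of the card: globalise the Nash units on a finite étale cover of the complement of a divisor,
compactify, and move the Zariski-labelled cocycle into the Čech complex of a Zariski cover);
`hBO` — the named fact `blochOgus1974_zariskiTransgression_algebraic` (Bloch–Ogus (1974)
Prop. (6.4), Cor. (6.9): classes transgressed from Čech cocycles of a Zariski cover lie in
`Nᵖ H²ᵖ`). Conclusion: the registered band stub `stub_nashHighBandAlgebraic`. Proof: `φ^* c` is
algebraic on `W` by `hBO`; coniveau descends along `φ` (`g_! g^* = d •`, projection formula,
`mem_supportedClasses_of_map_mem_of_hasDegree`). [cite: BlochOgus1974ENS, Prop. (6.4) and Cor. (6.9)]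
[cite: FultonYoungTableaux1997, Appendix B §B.1 (5)–(7)] -/
theorem nashHighBandAlgebraic_of_zariskiDescent :
    (∀ ⦃n : ℕ⦄ ⦃X : SchemeOver ℂ⦄, IsSmoothProjective n X → ∀ (q : ℕ), 2 ≤ q → q + 3 ≤ n →
      ∀ (c : complexBetti X (2 * (q + 1))), IsRationalClass c → IsNashSymbolClass n X q c →
        ∃ (W : SchemeOver ℂ) (φ : W ⟶ X) (μ : HomologicalOrientation ℂ (ComplexPoints W) (2 * n))
          (ν : HomologicalOrientation ℂ (ComplexPoints X) (2 * n)) (d : ℤ),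
          IsSmoothProjective n W ∧ d ≠ 0 ∧ HasDegree μ ν (AlgPoints.mapContinuous (L := ℂ) φ) d ∧
          ∃ (B : HodgeModel n W) (ι : Type) (V : ι → W.left.Opens) (U : ι → Set B.carrier)
            (hU : ∀ i, IsOpen (U i)),
            (∀ i, U i = B.toComplexPoints ⁻¹' {P | P.pt ∈ V i}) ∧ (∀ x, ∃ i, x ∈ U i) ∧
            ∃ (w : (Fin (q + 2) → ι) → MForm 𝓘(ℝ, B.model) B.carrier ℂ (q + 1))
              (θ : cclosedSmoothForms B.model B.carrier (2 * q + 1 + 1)) (m : ℤ),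
              IsTransgression hU q w θ ∧ m ≠ 0 ∧
              B.deRham B.carrier (2 * q + 1 + 1)
                  (complexDeRhamCohomology.mk B.model B.carrier (2 * q + 1 + 1) θ) =
                (m : ℂ) • B.pullback (2 * q + 1 + 1) (complexBetti.map φ (2 * (q + 1)) c)) →
    blochOgus1974_zariskiTransgression_algebraic →
    ∀ ⦃n : ℕ⦄ ⦃X : SchemeOver ℂ⦄, IsSmoothProjective n X → ∀ (q : ℕ), 2 ≤ q → q + 3 ≤ n →
      ∀ (c : complexBetti X (2 * (q + 1))), IsRationalClass c → IsNashSymbolClass n X q c →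
        c ∈ algebraicClasses X (q + 1) := by
  intro hZ hBO n X hX q hq hqn c hc hs
  obtain ⟨W, φ, μ, ν, d, hW, hd, hdeg, B, ι, V, U, hU, hUV, hcov, w, θ, m, hT, hm, hdR⟩ :=
    hZ hX q hq hqn c hc hs
  -- (BO) the pulled-back class is algebraic on `W`
  have hφc : complexBetti.map φ (2 * (q + 1)) c ∈ algebraicClasses W (q + 1) :=
    hBO hW B q V U hU hUV hcov w θ m _ hT hm hdR
  -- (descent) coniveau descends along `φ`, of degree `d ≠ 0`
  exact mem_supportedClasses_of_map_mem_of_hasDegree hW hX φ μ ν hd hdeg hφc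

/-- **(W_alg-band) from Zariski descent on `X` itself and Bloch–Ogus** (the case `W = X`,
`φ = 𝟙` of `nashHighBandAlgebraic_of_zariskiDescent`, proved directly: no degree is needed):
if every rational Nash symbol class of the band is, on some Hodge model of `X`, a non-zero
integer multiple of a class transgressed from a Čech cochain of the analytic cover defined by
ZARISKI opens of `X`, then it is algebraic by `blochOgus1974_zariskiTransgression_algebraic`.
[cite: BlochOgus1974ENS, Prop. (6.4) and Cor. (6.9)] -/
theorem nashHighBandAlgebraic_of_zariskiCarried
    (hZ : ∀ ⦃n : ℕ⦄ ⦃X : SchemeOver ℂ⦄, IsSmoothProjective n X → ∀ (q : ℕ), 2 ≤ q → q + 3 ≤ n →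
      ∀ (c : complexBetti X (2 * (q + 1))), IsRationalClass c → IsNashSymbolClass n X q c →
        ∃ (A : HodgeModel n X) (ι : Type) (V : ι → X.left.Opens) (U : ι → Set A.carrier)
          (hU : ∀ i, IsOpen (U i)),
          (∀ i, U i = A.toComplexPoints ⁻¹' {P | P.pt ∈ V i}) ∧ (∀ x, ∃ i, x ∈ U i) ∧
          ∃ (w : (Fin (q + 2) → ι) → MForm 𝓘(ℝ, A.model) A.carrier ℂ (q + 1))
            (θ : cclosedSmoothForms A.model A.carrier (2 * q + 1 + 1)) (m : ℤ),
            IsTransgression hU q w θ ∧ m ≠ 0 ∧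
            A.deRham A.carrier (2 * q + 1 + 1)
                (complexDeRhamCohomology.mk A.model A.carrier (2 * q + 1 + 1) θ) =
              (m : ℂ) • A.pullback (2 * q + 1 + 1) c)
    (hBO : blochOgus1974_zariskiTransgression_algebraic) ⦃n : ℕ⦄ ⦃X : SchemeOver ℂ⦄
    (hX : IsSmoothProjective n X) (q : ℕ) (hq : 2 ≤ q) (hqn : q + 3 ≤ n)
    (c : complexBetti X (2 * (q + 1))) (hc : IsRationalClass c) (hs : IsNashSymbolClass n X q c) :
    c ∈ algebraicClasses X (q + 1) := by
  obtain ⟨A, ι, V, U, hU, hUV, hcov, w, θ, m, hT, hm, hdR⟩ := hZ hX q hq hqn c hc hs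
  exact hBO hX A q V U hU hUV hcov w θ m c hT hm hdR

/-! ### The two-step form: globalisation with Zariski labels (G) and analytic-to-Zariski (Z) -/

/-- **(W_alg-band) from globalisation, analytic-to-Zariski transport, and Bloch–Ogus** (the
two-step form of Zariski descent). Hypotheses: `hG` — (G) GLOBALISATION WITH ZARISKI LABELS: after
a base change `φ : W ⟶ X` of non-zero degree from a smooth projective `n`-fold, the class `φ^* c`
of a rational Nash symbol class of the band is carried (`m ≠ 0`, `IsTransgression` of the symbol
forms) on a Hodge model `B` of `W` by a Milnor symbol cocycle `σ` of a finite ANALYTIC open cover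
all of whose units are pull-backs `y ↦ s(B.toComplexPoints y)` of REGULAR functions
`s ∈ Γ(O, 𝒪_W)` on Zariski opens `O ⊇` (the image of) `U_J` (card, step (G): Nash units become
rational, hence — `W` being smooth — regular near `U_J`, after the finite étale globalisation and
Hironaka); `hZL` — (Z) ZARISKI-LABELLED SYMBOL CLASSES ARE ZARISKI TRANSGRESSIONS: such a class is,
on some Hodge model, a non-zero integer multiple of a class transgressed from a Čech cochain of
the analytic cover defined by Zariski opens (Leray for `W^an → W_Zar`; for the Milnor `K`-sheaf:
étale-to-Zariski descent and `Hᵖ(W_Zar, 𝒦^M_p) ≅ CHᵖ(W)`, Kerz (2009) Thm. 1.1); `hBO` — the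
named fact `blochOgus1974_zariskiTransgression_algebraic`. Conclusion: the band stub, through
`nashHighBandAlgebraic_of_zariskiDescent` (`hG ∧ hZL` give its hypothesis `hZ`; rational classes
pull back to rational classes, `IsRationalClass.pullback`).
[cite: BlochOgus1974ENS, Prop. (6.4) and Cor. (6.9)] [cite: Kerz2009GerstenMilnorK, Thm. 1.1] -/
theorem nashHighBandAlgebraic_of_globalisation :
    (∀ ⦃n : ℕ⦄ ⦃X : SchemeOver ℂ⦄, IsSmoothProjective n X → ∀ (q : ℕ), 2 ≤ q → q + 3 ≤ n →
      ∀ (c : complexBetti X (2 * (q + 1))), IsRationalClass c → IsNashSymbolClass n X q c →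
        ∃ (W : SchemeOver ℂ) (φ : W ⟶ X) (μ : HomologicalOrientation ℂ (ComplexPoints W) (2 * n))
          (ν : HomologicalOrientation ℂ (ComplexPoints X) (2 * n)) (d : ℤ),
          IsSmoothProjective n W ∧ d ≠ 0 ∧ HasDegree μ ν (AlgPoints.mapContinuous (L := ℂ) φ) d ∧
          ∃ (B : HodgeModel n W) (ι : Type) (_ : Fintype ι) (U : ι → Set B.carrier)
            (hU : ∀ i, IsOpen (U i)) (_ : ∀ x, ∃ i, x ∈ U i)
            (σ : (Fin (q + 2) → ι) → ((Fin (q + 1) → B.carrier → ℂ) →₀ ℤ))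
            (_ : IsMilnorSymbolCocycle B.model U σ)
            (_ : ∀ J, ∀ t ∈ (σ J).support, ∀ k, ∃ (O : W.left.Opens) (s : Γ(W.left, O)),
              cechSet U J ⊆ B.toComplexPoints ⁻¹' {P | P.pt ∈ O} ∧
                ∀ y ∈ cechSet U J, t k y = AlgPoints.evalOrZero O s (B.toComplexPoints y))
            (θ : cclosedSmoothForms B.model B.carrier (2 * q + 1 + 1)) (m : ℤ),
            m ≠ 0 ∧ IsTransgression hU q (fun J ↦ symbolForm B.model (q + 1) (σ J)) θ ∧
              B.deRham B.carrier (2 * q + 1 + 1)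
                  (complexDeRhamCohomology.mk B.model B.carrier (2 * q + 1 + 1) θ) =
                (m : ℂ) • B.pullback (2 * q + 1 + 1) (complexBetti.map φ (2 * (q + 1)) c)) →
    (∀ ⦃n : ℕ⦄ ⦃W : SchemeOver ℂ⦄, IsSmoothProjective n W → ∀ (q : ℕ), 2 ≤ q → q + 3 ≤ n →
      ∀ (x : complexBetti W (2 * (q + 1))), IsRationalClass x →
        (∃ (B : HodgeModel n W) (ι : Type) (_ : Fintype ι) (U : ι → Set B.carrier)
            (hU : ∀ i, IsOpen (U i)) (_ : ∀ x, ∃ i, x ∈ U i)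
            (σ : (Fin (q + 2) → ι) → ((Fin (q + 1) → B.carrier → ℂ) →₀ ℤ))
            (_ : IsMilnorSymbolCocycle B.model U σ)
            (_ : ∀ J, ∀ t ∈ (σ J).support, ∀ k, ∃ (O : W.left.Opens) (s : Γ(W.left, O)),
              cechSet U J ⊆ B.toComplexPoints ⁻¹' {P | P.pt ∈ O} ∧
                ∀ y ∈ cechSet U J, t k y = AlgPoints.evalOrZero O s (B.toComplexPoints y))
            (θ : cclosedSmoothForms B.model B.carrier (2 * q + 1 + 1)) (m : ℤ),
            m ≠ 0 ∧ IsTransgression hU q (fun J ↦ symbolForm B.model (q + 1) (σ J)) θ ∧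
              B.deRham B.carrier (2 * q + 1 + 1)
                  (complexDeRhamCohomology.mk B.model B.carrier (2 * q + 1 + 1) θ) =
                (m : ℂ) • B.pullback (2 * q + 1 + 1) x) →
        ∃ (B : HodgeModel n W) (ι : Type) (V : ι → W.left.Opens) (U : ι → Set B.carrier)
          (hU : ∀ i, IsOpen (U i)),
          (∀ i, U i = B.toComplexPoints ⁻¹' {P | P.pt ∈ V i}) ∧ (∀ x, ∃ i, x ∈ U i) ∧
          ∃ (w : (Fin (q + 2) → ι) → MForm 𝓘(ℝ, B.model) B.carrier ℂ (q + 1))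
            (θ : cclosedSmoothForms B.model B.carrier (2 * q + 1 + 1)) (m : ℤ),
            IsTransgression hU q w θ ∧ m ≠ 0 ∧
            B.deRham B.carrier (2 * q + 1 + 1)
                (complexDeRhamCohomology.mk B.model B.carrier (2 * q + 1 + 1) θ) =
              (m : ℂ) • B.pullback (2 * q + 1 + 1) x) →
    blochOgus1974_zariskiTransgression_algebraic →
    ∀ ⦃n : ℕ⦄ ⦃X : SchemeOver ℂ⦄, IsSmoothProjective n X → ∀ (q : ℕ), 2 ≤ q → q + 3 ≤ n →
      ∀ (c : complexBetti X (2 * (q + 1))), IsRationalClass c → IsNashSymbolClass n X q c →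
        c ∈ algebraicClasses X (q + 1) := by
  intro hG hZL hBO
  refine nashHighBandAlgebraic_of_zariskiDescent (fun n X hX q hq hqn c hc hs ↦ ?_) hBO
  obtain ⟨W, φ, μ, ν, d, hW, hd, hdeg, hcarried⟩ := hG hX q hq hqn c hc hs
  have hφc : IsRationalClass (complexBetti.map φ (2 * (q + 1)) c) :=
    hc.pullback (AlgPoints.mapContinuous (L := ℂ) φ)
  exact ⟨W, φ, μ, ν, d, hW, hd, hdeg, hZL hW q hq hqn _ hφc hcarried⟩

/-! ### Consequence for the stub (W_alg, weights `≥ 3`) -/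

/-- **(W_alg, weights `≥ 3`) from Zariski descent in the band and Bloch–Ogus**: under `hZ` and
the fact, every rational Nash symbol class of weight `q + 1 ≥ 3` is algebraic
(`nashSymbolClassesAlgebraicHigh_of_band` fed with `nashHighBandAlgebraic_of_zariskiDescent`; the
cases outside the band are unconditional). [cite: BlochOgus1974ENS, Prop. (6.4) and Cor. (6.9)] -/
theorem nashSymbolClassesAlgebraicHigh_of_zariskiDescent
    (hZ : ∀ ⦃n : ℕ⦄ ⦃X : SchemeOver ℂ⦄, IsSmoothProjective n X → ∀ (q : ℕ), 2 ≤ q → q + 3 ≤ n →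
      ∀ (c : complexBetti X (2 * (q + 1))), IsRationalClass c → IsNashSymbolClass n X q c →
        ∃ (W : SchemeOver ℂ) (φ : W ⟶ X) (μ : HomologicalOrientation ℂ (ComplexPoints W) (2 * n))
          (ν : HomologicalOrientation ℂ (ComplexPoints X) (2 * n)) (d : ℤ),
          IsSmoothProjective n W ∧ d ≠ 0 ∧ HasDegree μ ν (AlgPoints.mapContinuous (L := ℂ) φ) d ∧
          ∃ (B : HodgeModel n W) (ι : Type) (V : ι → W.left.Opens) (U : ι → Set B.carrier)
            (hU : ∀ i, IsOpen (U i)),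
            (∀ i, U i = B.toComplexPoints ⁻¹' {P | P.pt ∈ V i}) ∧ (∀ x, ∃ i, x ∈ U i) ∧
            ∃ (w : (Fin (q + 2) → ι) → MForm 𝓘(ℝ, B.model) B.carrier ℂ (q + 1))
              (θ : cclosedSmoothForms B.model B.carrier (2 * q + 1 + 1)) (m : ℤ),
              IsTransgression hU q w θ ∧ m ≠ 0 ∧
              B.deRham B.carrier (2 * q + 1 + 1)
                  (complexDeRhamCohomology.mk B.model B.carrier (2 * q + 1 + 1) θ) =
                (m : ℂ) • B.pullback (2 * q + 1 + 1) (complexBetti.map φ (2 * (q + 1)) c))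
    (hBO : blochOgus1974_zariskiTransgression_algebraic) : NashSymbolClassesAlgebraicHigh :=
  nashSymbolClassesAlgebraicHigh_of_band (nashHighBandAlgebraic_of_zariskiDescent hZ hBO)

end Summit.HodgeConjecture.HodgeConjecture.Theorems.MilnorKExponentialNash

end
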